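import Literature.MathematicalPhysics.QuantumFieldTheory.Balaban1983to89.B9Thm311TouchingClassOfCoerciveZd

/-!
# `Balaban1983to89.B9Thm311ContinuityMethodRegularZd` — [Balaban1985BackgroundPropagators] Thm 3.11 p. 416 ∕ (3.27) p. 395 ∕ (3.115) p. 418 AT THE `ℤᵈ × 𝔸`
# CARRIER: THE CONTINUITY METHOD FOR THE EXISTENCE OF `G_𝔤(U₀) = (□₀Δ_a(U₀)□₀)⁻¹` IN PRINT'S OWN CURRENCY — a UNIFORM BOUND ON `|G(U₀)|` at the regular
# points of a preconnected family (print's (3.115)) ⟹ `G` exists along the whole family; NO symmetry and NO positivity of `Δ_a(U₀)` are used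

statement-level skeleton of published theorems with citation tags; proofs where landed; nothing here is a claim about the
Yang–Mills mass gap

`[Balaban1985BackgroundPropagators]` ("B9", CMP **99** (1985) 389–434) p. 416 Theorem 3.11 and its proof: the curved case follows from the representations
of `G` of Sects. B–E *together with the bound (3.115)* p. 418 — `|G(U)|` bounded uniformly for `U` in the class (3.35); (3.27) p. 395 `G(U₀) = (Ω₀Δ_aΩ₀)⁻¹`.
PDF held: `paper:balaban1985-cmp99-background-propagators` pp. 395, 416–418.

CITATION HEADER ∕ WHY THIS FILE (cell `pub-ymgap`, HUMAN RULING D-0062 ∕ D-0149; width seat `pub-ymgap-dag-n06-w3` (g4), node N06 = [B9]; CLAIM-4; count-neutral).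
dag-n06-w4 g3's `B9Thm311ContinuityMethodZd` runs the continuity method for POSITIVE-DEFINITENESS of `Δ_a(U₀)` and displays a uniform COERCIVITY
`c⟨A,A⟩ ≤ ⟨A, Δ_aA⟩` at the positive points; print's (3.115) is a bound on the INVERSE `G`, which controls `⟨Δ_aA, Δ_aA⟩`, not `⟨A, Δ_aA⟩`, unless `Δ_a(U₀)` is
symmetric.  THIS FILE runs the method for REGULARITY (what (3.27) and the junction's binder `InvAtHI` of dag-n06-b g20 need): the regular set is open
(dag-n06-w4 g3's engine `posDef_eventually_of_continuousWithinAt` on the RESIDUAL forms `⟨□₀Δ_aA, □₀Δ_aB⟩_τ`) and closed under the displayed bound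
`c⟨A, A⟩_τ ≤ ⟨□₀Δ_a(U₀)A, □₀Δ_a(U₀)A⟩_τ` = `‖G_𝔤(U₀)‖_τ ≤ c^{−1∕2}` (their `forall_pos_of_isPreconnected`), then instantiates it on this seat's families
(CLAIM-1 ball) and on print's local class with the explicit window of CLAIM-3 (`of_touching_plaquettes_unitary_explicit` over dag-n05-w3's layer gauge,
this seat's g3 box-clause covariance `regularAtH_opsAllZd_gaugeAct_iff`, dag-n06-b g20's `regular_opsAllZd_congr_cube_sides`), ending in the junction's
`InvAtHI` with an explicit threshold.  The `𝒩_δ` version (this seat's `B9Eq336GaugeOrbitConnectedZd`) is the same three lines and is left to the consumer.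

WHAT IS PROVED (kernel, 0 sorry; theorems only — no `def`, `instance`, `notation`).
* §1 ★ `regularAtH_of_residual_pos` (injective on `E_𝔤(Ω₀)` ⟹ `RegularAtH`; generalises dag-n06-b's `regularAtH_of_bondPair_pos`) · ★ `residual_pos_of_regularAtH`.
* §2 `continuous_tauForm₂` · `continuousWithinAt_residual` · ★★ `regularAtH_eventually` (REGULARITY IS OPEN in the background within any class where `Δ_a` is
  ℝ-linear, Hermiticity-preserving, with continuous letters).
* §3 ★★★ `regularAtH_on_of_isPreconnected` — THE CONTINUITY METHOD FOR `G`: preconnected `S`, structure + letter continuity on `S`, the uniform bound at the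
  REGULAR points of `S`, one regular point ⟹ `RegularAtH` on all of `S`.
* §4 (cube members, class `cubeLamBP`, `m ≤ k`, `2 ≤ d`, `2 ≤ L ≤ ρ`; faithful Hermitian tracial `τ`) `regularAtH_one_cube` · ★★★ `regularAtH_on_ball_of_gbound`
  (`0 < δ`, `4δ < (α_Q∕L²)L^{−2m}`) · ★★★ `regularAtH_of_plaqTouches_of_gbound` (every unitary `U₀` with touching plaquettes `α`-close, `(|□₀|₁ + 1)·α < δ`) ·
  ★★★ `invAtHI_withGopZdH_of_gbound` (dag-n06-b's binder, every `aI` with `(|□₀|₁ + 1)·aI < δ`).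

HONEST SCOPE.  Linear algebra + point-set topology + by-name composition; CONDITIONAL on the displayed bound on `|G|` (print's (3.115) — N06's object-bound,
Sects. B–E, NOT proved; read here in the `L²(τ)` operator norm on `E_𝔤(□₀)`, print's is a weighted sup norm); explicit but member-dependent window; no estimate
of [B9]; count-neutral helper; N05 ∕ N06 NOT discharged; K1⁸ `stmt-QuantumFields-26907` NOT closed; one finite `𝕋⁴` programme at fixed `ε`, Bałaban as
printed; R4 closes only the conditional finite-`𝕋⁴` rung `BalabanLadder.UV` — nothing continuum ∕ ℝ⁴ ∕ OS ∕ mass gap ∕ Clay.  Unit `pub-ymgap-dag-n06-w3` (g4), 2026-08-28.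
-/

noncomputable section

namespace Literature.MathematicalPhysics.QuantumFieldTheory.Balaban1983to89.B9Thm311ContinuityMethodRegularZd

open scoped Topology
open Filter
open B7Prop1Explicit
open B7Prop2Explicit (unitaryUnits unitaryUnits_le_U1)
open B8Ineq132 (BondTouches)
open B9SupplySockB9P3ZdLetters (OpsZd deltaAOf)
open B9Eq316AveragingTransposeZd (tauForm tauForm_apply)
open B9SupplySockB9P3ZdLettersOmega (restrictDom restrictDom_of restrictDom_of_not)
open B9Eq327GreenZd (domSub bondPair deltaADom LinearOnDomAt setOf_bondTouches_finite support_finite_of_mem_domSub bondPair_self_pos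
  restrictDom_mem_domSub bondPair_zero_right)
open B9Eq327GreenZdHerm (domSubH domSubH_le mem_domSubH_iff HermPreservingAt RegularAtH finiteDimensional_domSubH)
open B9Thm311PosDefOpenZd (LettersContinuousWithinAt posDef_eventually_of_continuousWithinAt eq_zero_of_not_mem_bondFinset continuous_tauForm_right)
open B9Thm311FlatHermKernelZd (bondPair_eq_sum_of_vanish_off)
open B9Thm311ContinuityMethodZd (forall_pos_of_isPreconnected)

-- `Site` alone could resolve to the torus sites of `Setup.lean`; re-export the `ℤ^d` sites of `B7Prop1Explicit`.
export B7Prop1Explicit (Site)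

variable {d : ℕ} {𝔸 : Type*} [CStarAlgebra 𝔸] (τ : 𝔸 →ₗ[ℂ] ℂ)

/-! ## §1  Regularity ⟺ positivity of the RESIDUAL form `A ↦ ⟨Ω₀Δ_a(U₀)A, Ω₀Δ_a(U₀)A⟩_τ` on `E_𝔤(Ω₀)` -/

section Residual

/-- ★ **REGULARITY FROM A RESIDUAL LOWER BOUND — NO POSITIVITY, NO SYMMETRY** (finite `Ω₀`, finite-dimensional fibre): if `Δ_a(U₀)` is the restriction of
an ℝ-linear map on `E(Ω₀)`, preserves Hermiticity on `E_𝔤(Ω₀)`, and `⟨Ω₀Δ_a(U₀)A, Ω₀Δ_a(U₀)A⟩_τ > 0` for every `0 ≠ A ∈ E_𝔤(Ω₀)` (i.e. `Ω₀Δ_a(U₀)` kills no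
Hermitian field of `E(Ω₀)`), then `Δ_a(U₀)↾Ω₀` is an invertible operator of `E_𝔤(Ω₀)` — injective ⟹ bijective; the generalisation of dag-n06-b's
`regularAtH_of_bondPair_pos` that print's Theorem 3.11 proof actually uses (existence of `G`, (3.27)). [cite: Balaban1985BackgroundPropagators, Thm 3.11 p.416, (3.27) p.395] -/
theorem regularAtH_of_residual_pos [FiniteDimensional ℝ 𝔸] {η : ℝ} {o : OpsZd d 𝔸} {Ω₀ : Set (Site d)} {U₀ : Site d → Fin d → 𝔸ˣ}
    (hΩ : Ω₀.Finite) (hlin : LinearOnDomAt η o Ω₀ U₀) (hherm : HermPreservingAt η o Ω₀ U₀)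
    (hres : ∀ A ∈ domSubH (𝔸 := 𝔸) Ω₀, A ≠ 0 → 0 < bondPair τ (deltaADom η o Ω₀ U₀ A) (deltaADom η o Ω₀ U₀ A)) :
    RegularAtH η o Ω₀ U₀ := by
  classical
  haveI := finiteDimensional_domSubH (𝔸 := 𝔸) hΩ
  obtain ⟨T, hT⟩ := hlin
  have hval : ∀ A : domSubH (𝔸 := 𝔸) Ω₀, restrictDom Ω₀ (T A) ∈ domSubH (𝔸 := 𝔸) Ω₀ := by
    intro A
    refine ⟨restrictDom_mem_domSub Ω₀ _, fun y τ' => ?_⟩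
    by_cases hb : BondTouches Ω₀ y τ'
    · rw [restrictDom_of _ hb, hT A (domSubH_le Ω₀ A.2)]
      exact hherm A A.2 y τ' hb
    · rw [restrictDom_of_not _ hb]; exact IsSelfAdjoint.zero _
  let Φ : domSubH (𝔸 := 𝔸) Ω₀ →ₗ[ℝ] domSubH (𝔸 := 𝔸) Ω₀ :=
    { toFun := fun A => ⟨restrictDom Ω₀ (T A), hval A⟩
      map_add' := fun A B => by
        apply Subtype.ext
        simp only [Submodule.coe_add, map_add, B9Eq327GreenZd.restrictDom_add']
      map_smul' := fun c A => by
        apply Subtype.ext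
        simp only [Submodule.coe_smul, map_smul, RingHom.id_apply, B9Eq327GreenZd.restrictDom_smul'] }
  have hΦ : ∀ A : domSubH (𝔸 := 𝔸) Ω₀, (Φ A : Site d → Fin d → 𝔸) = deltaADom η o Ω₀ U₀ A := by
    intro A
    show restrictDom Ω₀ (T A) = restrictDom Ω₀ (deltaAOf η o U₀ A)
    rw [hT A (domSubH_le Ω₀ A.2)]
  have hinj : Function.Injective Φ := by
    intro A B hAB
    by_contra hne
    have hne' : ((A - B : domSubH (𝔸 := 𝔸) Ω₀) : Site d → Fin d → 𝔸) ≠ 0 := by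
      intro h0
      exact hne (sub_eq_zero.1 (Subtype.ext h0))
    have hp := hres _ (A - B).2 hne'
    have hzero : (Φ (A - B) : Site d → Fin d → 𝔸) = 0 := by rw [map_sub, hAB, sub_self, Submodule.coe_zero]
    rw [← hΦ, hzero, bondPair_zero_right] at hp
    exact lt_irrefl _ hp
  exact ⟨Φ, hΦ, hinj, LinearMap.injective_iff_surjective.1 hinj⟩

/-- ★ **CONVERSELY, AT A REGULAR BACKGROUND THE RESIDUAL FORM IS POSITIVE DEFINITE ON `E_𝔤(Ω₀)`** (faithful `τ`): `Ω₀Δ_a(U₀)A ≠ 0` for `0 ≠ A ∈ E_𝔤(Ω₀)`.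
[cite: Balaban1985BackgroundPropagators, (3.27) p.395, Thm 3.11 p.416] -/
theorem residual_pos_of_regularAtH (hτp : ∀ a : 𝔸, a ≠ 0 → 0 < (τ (star a * a)).re) {η : ℝ} {o : OpsZd d 𝔸} {Ω₀ : Set (Site d)}
    {U₀ : Site d → Fin d → 𝔸ˣ} (hΩ : Ω₀.Finite) (hreg : RegularAtH η o Ω₀ U₀) :
    ∀ A ∈ domSubH (𝔸 := 𝔸) Ω₀, A ≠ 0 → 0 < bondPair τ (deltaADom η o Ω₀ U₀ A) (deltaADom η o Ω₀ U₀ A) := by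
  intro A hA hA0
  obtain ⟨Φ, hΦ, hbij⟩ := hreg
  have hne : deltaADom η o Ω₀ U₀ A ≠ 0 := by
    intro h0
    have h1 : Φ ⟨A, hA⟩ = 0 := by
      apply Subtype.ext
      rw [hΦ ⟨A, hA⟩, Submodule.coe_zero]
      exact h0
    have h2 : (⟨A, hA⟩ : domSubH (𝔸 := 𝔸) Ω₀) = 0 := hbij.1 (by rw [h1, map_zero])
    exact hA0 (congrArg Subtype.val h2)
  exact bondPair_self_pos τ hτp (fun μ => support_finite_of_mem_domSub hΩ (restrictDom_mem_domSub Ω₀ _) μ) hne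

end Residual

/-! ## §2  Openness: regularity propagates to nearby backgrounds (the residual form is continuous in `U₀`) -/

section Open

variable [FiniteDimensional ℝ 𝔸]

omit [FiniteDimensional ℝ 𝔸] in
/-- the fibre pairing is jointly continuous on a finite-dimensional fibre. [cite: Balaban1985BackgroundPropagators, p.391 («X·Y = tr XY») (bookkeeping)] -/
theorem continuous_tauForm₂ [FiniteDimensional ℝ 𝔸] : Continuous fun p : 𝔸 × 𝔸 => tauForm τ p.1 p.2 := by
  have hτ : Continuous fun a : 𝔸 => τ a := (τ.restrictScalars ℝ).continuous_of_finiteDimensional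
  simp only [tauForm_apply]
  exact Complex.continuous_re.comp (hτ.comp ((continuous_star.comp continuous_fst).mul continuous_snd))

/-- the residual pairing `U₀ ↦ ⟨Ω₀Δ_a(U₀)A, Ω₀Δ_a(U₀)A⟩_τ` is continuous within `S` at a point where the letters are (finite `Ω₀`; a finite sum of jointly
continuous fibre pairings). [cite: Balaban1985BackgroundPropagators, (3.26)–(3.27) p.395 (bookkeeping)] -/
theorem continuousWithinAt_residual {η : ℝ} {o : OpsZd d 𝔸} {Ω₀ : Set (Site d)} (hΩ : Ω₀.Finite)
    {W : Submodule ℝ (Site d → Fin d → 𝔸)} {S : Set (Site d → Fin d → 𝔸ˣ)} {U₁ : Site d → Fin d → 𝔸ˣ}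
    (hcont : LettersContinuousWithinAt η o Ω₀ W S U₁) {A : Site d → Fin d → 𝔸} (hA : A ∈ W) :
    ContinuousWithinAt (fun U₀ => bondPair τ (deltaADom η o Ω₀ U₀ A) (deltaADom η o Ω₀ U₀ A)) S U₁ := by
  classical
  let T : Finset (Site d × Fin d) := (setOf_bondTouches_finite (d := d) hΩ).toFinset
  have hvan : ∀ U₀, ∀ b : Site d × Fin d, b ∉ T → deltaADom η o Ω₀ U₀ A b.1 b.2 = 0 :=
    fun U₀ b hb => eq_zero_of_not_mem_bondFinset hΩ (restrictDom_mem_domSub Ω₀ _) b hb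
  have heq : (fun U₀ => bondPair τ (deltaADom η o Ω₀ U₀ A) (deltaADom η o Ω₀ U₀ A)) =
      fun U₀ => ∑ b ∈ T, tauForm τ (deltaADom η o Ω₀ U₀ A b.1 b.2) (deltaADom η o Ω₀ U₀ A b.1 b.2) := by
    funext U₀
    exact bondPair_eq_sum_of_vanish_off τ T (hvan U₀) _
  rw [heq]
  refine tendsto_finsetSum _ fun b hb => ?_
  have hbT : BondTouches Ω₀ b.1 b.2 := (setOf_bondTouches_finite (d := d) hΩ).mem_toFinset.1 hb
  have hc : ContinuousWithinAt (fun U₀ => deltaADom η o Ω₀ U₀ A b.1 b.2) S U₁ := by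
    have h := hcont A hA b.1 b.2 hbT
    refine h.congr (fun U₀ _ => ?_) ?_ <;> exact restrictDom_of _ hbT
  exact ((continuous_tauForm₂ τ).tendsto _).comp (hc.prodMk_nhds hc)

/-- ★★ **REGULARITY IS OPEN IN THE BACKGROUND** (finite `Ω₀`, finite-dimensional fibre, faithful `τ`): if `Δ_a(U₀)` is ℝ-linear on `E(Ω₀)` and Hermiticity-
preserving for every `U₀ ∈ 𝒰`, its letters are continuous within `𝒰` at `U₁` on `E_𝔤(Ω₀)`, and `Δ_a(U₁)↾Ω₀` is invertible on `E_𝔤(Ω₀)`, then `Δ_a(U₀)↾Ω₀` is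
invertible on `E_𝔤(Ω₀)` for all `U₀ ∈ 𝒰` NEAR `U₁` — dag-n06-w4 g3's openness engine `posDef_eventually_of_continuousWithinAt` applied to the RESIDUAL forms
`(A, B) ↦ ⟨Ω₀Δ_a(U₀)A, Ω₀Δ_a(U₀)B⟩_τ`. [cite: Balaban1985BackgroundPropagators, Thm 3.11 p.416, (3.27) p.395] -/
theorem regularAtH_eventually (hτp : ∀ a : 𝔸, a ≠ 0 → 0 < (τ (star a * a)).re) {η : ℝ} {o : OpsZd d 𝔸} {Ω₀ : Set (Site d)}
    (hΩ : Ω₀.Finite) {𝒰 : Set (Site d → Fin d → 𝔸ˣ)} {U₁ : Site d → Fin d → 𝔸ˣ} (hU₁ : U₁ ∈ 𝒰)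
    (hlin : ∀ U₀ ∈ 𝒰, LinearOnDomAt η o Ω₀ U₀) (hherm : ∀ U₀ ∈ 𝒰, HermPreservingAt η o Ω₀ U₀)
    (hcont : LettersContinuousWithinAt η o Ω₀ (domSubH Ω₀) 𝒰 U₁) (hreg : RegularAtH η o Ω₀ U₁) :
    ∀ᶠ U₀ in 𝓝[𝒰] U₁, RegularAtH η o Ω₀ U₀ := by
  classical
  haveI : FiniteDimensional ℝ (domSubH (𝔸 := 𝔸) Ω₀) := finiteDimensional_domSubH hΩ
  choose! T hT using hlin
  let S : Finset (Site d × Fin d) := (setOf_bondTouches_finite (d := d) hΩ).toFinset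
  have hSb : ∀ b ∈ S, BondTouches Ω₀ b.1 b.2 := fun b hb => (setOf_bondTouches_finite (d := d) hΩ).mem_toFinset.1 hb
  have hvan : ∀ (U : Site d → Fin d → 𝔸ˣ) (A : Site d → Fin d → 𝔸), ∀ b : Site d × Fin d, b ∉ S → deltaADom η o Ω₀ U A b.1 b.2 = 0 :=
    fun U A b hb => eq_zero_of_not_mem_bondFinset hΩ (restrictDom_mem_domSub Ω₀ _) b hb
  -- evaluation at a bond, as a linear map
  let ev : Site d × Fin d → ((Site d → Fin d → 𝔸) →ₗ[ℝ] 𝔸) := fun b =>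
    (LinearMap.proj (R := ℝ) (φ := fun _ : Fin d => 𝔸) b.2).comp (LinearMap.proj (R := ℝ) (φ := fun _ : Site d => Fin d → 𝔸) b.1)
  let W : Submodule ℝ (Site d → Fin d → 𝔸) := domSubH (𝔸 := 𝔸) Ω₀
  -- the residual bilinear forms `q U₀ (A, B) = Σ_{b ∈ S} Re τ((T U₀ A)(b)* (T U₀ B)(b))` on `E_𝔤(Ω₀)`
  let q : (Site d → Fin d → 𝔸ˣ) → W →ₗ[ℝ] W →ₗ[ℝ] ℝ := fun U =>
    ∑ b ∈ S, (tauForm τ).compl₁₂ ((ev b).comp ((T U).comp W.subtype)) ((ev b).comp ((T U).comp W.subtype))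
  have hq : ∀ U (A B : W), q U A B = ∑ b ∈ S, tauForm τ (T U A b.1 b.2) (T U B b.1 b.2) := by
    intro U A B
    simp only [q, LinearMap.sum_apply, LinearMap.compl₁₂_apply, LinearMap.comp_apply, Submodule.subtype_apply, ev,
      LinearMap.proj_apply]
  -- on `𝒰`, `T U A = Δ_a(U)A` and the restricted field agrees with it on `S`
  have hTS : ∀ U ∈ 𝒰, ∀ A : W, ∀ b ∈ S, T U A b.1 b.2 = deltaADom η o Ω₀ U A b.1 b.2 := by
    intro U hU A b hb
    rw [hT U hU A (domSubH_le Ω₀ A.2), deltaADom, restrictDom_of _ (hSb b hb)]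
  have hdiag : ∀ U ∈ 𝒰, ∀ A : W, q U A A = bondPair τ (deltaADom η o Ω₀ U A) (deltaADom η o Ω₀ U A) := by
    intro U hU A
    rw [hq, bondPair_eq_sum_of_vanish_off τ S (hvan U A)]
    exact Finset.sum_congr rfl fun b hb => by rw [hTS U hU A b hb]
  -- the entries are continuous within `𝒰` at `U₁`
  have hcq : ∀ A B : W, ContinuousWithinAt (fun U => q U A B) 𝒰 U₁ := by
    intro A B
    have hA : ∀ b ∈ S, ContinuousWithinAt (fun U => deltaADom η o Ω₀ U A b.1 b.2) 𝒰 U₁ := fun b hb => by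
      have h := hcont A A.2 b.1 b.2 (hSb b hb)
      refine h.congr (fun U _ => ?_) ?_ <;> exact restrictDom_of _ (hSb b hb)
    have hB : ∀ b ∈ S, ContinuousWithinAt (fun U => deltaADom η o Ω₀ U B b.1 b.2) 𝒰 U₁ := fun b hb => by
      have h := hcont B B.2 b.1 b.2 (hSb b hb)
      refine h.congr (fun U _ => ?_) ?_ <;> exact restrictDom_of _ (hSb b hb)
    have h : ContinuousWithinAt
        (fun U => ∑ b ∈ S, tauForm τ (deltaADom η o Ω₀ U A b.1 b.2) (deltaADom η o Ω₀ U B b.1 b.2)) 𝒰 U₁ :=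
      tendsto_finsetSum S fun b hb => ((continuous_tauForm₂ τ).tendsto _).comp ((hA b hb).prodMk_nhds (hB b hb))
    refine h.congr (fun U hU => ?_) ?_
    · rw [hq]
      exact Finset.sum_congr rfl fun b hb => by rw [hTS U hU A b hb, hTS U hU B b hb]
    · rw [hq]
      exact Finset.sum_congr rfl fun b hb => by rw [hTS U₁ hU₁ A b hb, hTS U₁ hU₁ B b hb]
  -- positivity of the residual form at `U₁`
  have hposq : ∀ A : W, A ≠ 0 → 0 < q U₁ A A := by
    intro A hA
    rw [hdiag U₁ hU₁ A]
    exact residual_pos_of_regularAtH τ hτp hΩ hreg A A.2 fun h => hA (Subtype.ext h)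
  have hev := posDef_eventually_of_continuousWithinAt q 𝒰 U₁ hcq hposq
  filter_upwards [hev, eventually_mem_nhdsWithin] with U hU hU𝒰
  refine regularAtH_of_residual_pos τ hΩ ⟨T U, hT U hU𝒰⟩ (hherm U hU𝒰) fun A hA hA0 => ?_
  have h := hU ⟨A, hA⟩ fun h => hA0 (congrArg Subtype.val h)
  rwa [hdiag U hU𝒰] at h

end Open

/-! ## §3  The continuity method FOR REGULARITY from a uniform bound on `G` — print's (3.115) currency, no symmetry, no positivity -/

section Method

variable [FiniteDimensional ℝ 𝔸]

/-- ★★★ **EXISTENCE OF `G(U₀)` ALONG A PRECONNECTED FAMILY FROM A UNIFORM BOUND ON `|G|`** (finite `Ω₀`, finite-dimensional fibre, faithful `τ`).  Let `S` be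
a preconnected set of backgrounds on which `Δ_a(U₀)` is ℝ-linear on `E(Ω₀)` and Hermiticity-preserving, whose letters are continuous within `S` at every point
of `S` on `E_𝔤(Ω₀)`; suppose that at every REGULAR `U₀ ∈ S` (where `G_𝔤(U₀) = (Ω₀Δ_a(U₀)Ω₀)⁻¹` exists) the UNIFORM bound
`c·⟨A, A⟩_τ ≤ ⟨Ω₀Δ_a(U₀)A, Ω₀Δ_a(U₀)A⟩_τ` holds on `E_𝔤(Ω₀)` — i.e. `‖G_𝔤(U₀)‖ ≤ c^{−1∕2}` in the `τ`-operator norm, print's a-priori bound (3.115)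
«|G(U)| ≤ C uniformly in the class» read in `L²(τ)` — and that `Δ_a(U₁)↾Ω₀` is invertible at one `U₁ ∈ S`.  Then `Δ_a(U₀)↾Ω₀` is invertible on `E_𝔤(Ω₀)` for
EVERY `U₀ ∈ S`.  (Open by §2; closed because a limit of backgrounds with `‖Ω₀Δ_aA‖ ≥ √c‖A‖` kills no field; connected does the rest — dag-n06-w4 g3's
`forall_pos_of_isPreconnected` on the residual forms.)  NO symmetry and NO positivity of `Δ_a(U₀)` enter. [cite: Balaban1985BackgroundPropagators, Thm 3.11 p.416, (3.115) p.418, (3.27) p.395] -/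
theorem regularAtH_on_of_isPreconnected (hτp : ∀ a : 𝔸, a ≠ 0 → 0 < (τ (star a * a)).re) {η : ℝ} {o : OpsZd d 𝔸} {Ω₀ : Set (Site d)}
    (hΩ : Ω₀.Finite) {S : Set (Site d → Fin d → 𝔸ˣ)} (hS : IsPreconnected S) (hlin : ∀ U₀ ∈ S, LinearOnDomAt η o Ω₀ U₀)
    (hherm : ∀ U₀ ∈ S, HermPreservingAt η o Ω₀ U₀) (hcont : ∀ U₁ ∈ S, LettersContinuousWithinAt η o Ω₀ (domSubH Ω₀) S U₁) {c : ℝ} (hc : 0 < c)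
    (hbound : ∀ U₀ ∈ S, RegularAtH η o Ω₀ U₀ →
      ∀ A ∈ domSubH (𝔸 := 𝔸) Ω₀, c * bondPair τ A A ≤ bondPair τ (deltaADom η o Ω₀ U₀ A) (deltaADom η o Ω₀ U₀ A))
    {U₁ : Site d → Fin d → 𝔸ˣ} (hU₁ : U₁ ∈ S) (hreg : RegularAtH η o Ω₀ U₁) :
    ∀ U₀ ∈ S, RegularAtH η o Ω₀ U₀ := by
  -- index the nonzero Hermitian fields; `f` = residual form, `N` = norm form
  let ι := {A : Site d → Fin d → 𝔸 // A ∈ domSubH (𝔸 := 𝔸) Ω₀ ∧ A ≠ 0}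
  let f : (Site d → Fin d → 𝔸ˣ) → ι → ℝ := fun U₀ A => bondPair τ (deltaADom η o Ω₀ U₀ A.1) (deltaADom η o Ω₀ U₀ A.1)
  let N : ι → ℝ := fun A => bondPair τ A.1 A.1
  have hN : ∀ A : ι, 0 < N A := fun A =>
    bondPair_self_pos τ hτp (fun μ => support_finite_of_mem_domSub hΩ (domSubH_le Ω₀ A.2.1) μ) A.2.2
  have hiff : ∀ U₀ ∈ S, (∀ A : ι, 0 < f U₀ A) ↔ RegularAtH η o Ω₀ U₀ := fun U₀ hU₀ =>
    ⟨fun h => regularAtH_of_residual_pos τ hΩ (hlin U₀ hU₀) (hherm U₀ hU₀) fun A hA hA0 => h ⟨A, hA, hA0⟩,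
      fun h A => residual_pos_of_regularAtH τ hτp hΩ h A.1 A.2.1 A.2.2⟩
  have key := forall_pos_of_isPreconnected S hS f N hN
    (fun x hx A => continuousWithinAt_residual τ hΩ (hcont x hx) A.2.1)
    (fun x hx hx' => by
      have h := regularAtH_eventually τ hτp hΩ hx hlin hherm (hcont x hx) ((hiff x hx).1 hx')
      filter_upwards [h, eventually_mem_nhdsWithin] with y hy hyS
      exact (hiff y hyS).2 hy)
    hc (fun x hx hx' A => hbound x hx ((hiff x hx).1 hx') A.1 A.2.1) hU₁ ((hiff U₁ hU₁).2 hreg)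
  intro U₀ hU₀
  exact (hiff U₀ hU₀).1 (key U₀ hU₀)

end Method

/-! ## §4  Cube members: `G_𝔤(U₀)` on the window-sized ball and on print's local class (explicit window), from the bound on `|G|` -/

section Cube

open B9SupplySockB9P3ZdAllLettersZd (opsAllZd)
open B9Eq316AveragingTransposeZd (Reg17 alphaQ alphaQ_pos)
open B9Eq17RegimeBallZd (ball_subset_reg17UnivP)
open B9Thm311PosDefOpenZd (cubeMember_Ω0_finite)
open B9Thm311FlatHermKernelZd (flat_posDef_herm_cube)
open B9Thm311PosDefOpenRegimeZd (lettersContinuousWithinAt_opsAllZd_cube_reg17UnivP)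
open B9Eq326DeltaAHermitianZdCurved (linear_herm_on_reg17UnivP one_mem_reg17UnivP)
open B9Eq327GreenZdHerm (regularAtH_of_bondPair_pos withGopZdH withGopZdH_Gop deltaAOf_withGopZdH gopZdH_apply_eq_of_regularAtH)
open B9Thm311SmallFieldPathZd (one_mem_ball isPreconnected_ball)
open B9Thm311SmallFieldPathZdContinuity (delta_le_two_of_window)
open B9Thm311TouchingClassOfCoerciveZd (of_touching_plaquettes_unitary_explicit)
open B9Thm311PerMemberCubeZdTouching (sqLo_le_sqHi_zero plaq_le_of_inAk)
open B9Eq326DeltaALocalityZdSides (regular_opsAllZd_congr_cube_sides)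
open B9Eq316AveragingTransposeZdLevelZero (hbox0_cubeLamBP_of_eq)
open B9SupplySockB9P3ZdAtHermInAk (InvAtHI invAtHI_of_forall)
open B7Prop1Local (InBox)
open B8Ineq132 (plaqF PlaqTouches InAk)
open B8Eq140Level (SideTouches)
open B8Eq131Cubes (cube sqLo sqHi)
open B8Eq131CubesAdmissible (cubeFam cubeFam_false_zero)
open B8CubeMemberZd (cubeLamS)
open B8Ineq159FlatCubeMemberPrinted (cubeLamBP)
open B8Ineq159FlatCubeMemberKernel (mem_cube_zero_iff)
open B8LeafModelZd (ZdIdx)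

variable [FiniteDimensional ℝ 𝔸] [Nontrivial 𝔸] {L : ℕ}
  (hτp : ∀ a : 𝔸, a ≠ 0 → 0 < (τ (star a * a)).re) (hτt : ∀ a b : 𝔸, τ (a * b) = τ (b * a))
  (hτs : ∀ a : 𝔸, τ (star a) = starRingEnd ℂ (τ a))

include hτp hτt hτs in
/-- the flat background is a regular point at every cube member (dag-n06-b's flat positivity ⟹ injectivity). [cite: Balaban1985BackgroundPropagators, Thm 3.11 p.416 («G_□(1) is positive»), (3.27) p.395] -/
theorem regularAtH_one_cube (hd2 : 2 ≤ d) (hL2 : 2 ≤ L) (ops₀ : ℝ → ZdIdx d L → ℕ → OpsZd d 𝔸) (M : ℝ) (i : ZdIdx d L)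
    {a : Site d} {Mc ρ : ℕ} (hΩ : i.Ω = cubeFam false L a Mc ρ i.k) (hΛs : i.Λs = cubeLamS L a Mc ρ i.k) {m : ℕ} (hm : m ≤ i.k) :
    RegularAtH i.η (opsAllZd τ L (cubeLamBP L a Mc ρ i.k) ops₀ M i m) (i.Ω 0) 1 := by
  have hL1 : 1 ≤ L := le_trans (by norm_num) hL2
  have hfin := cubeMember_Ω0_finite i hΩ
  have hstr := linear_herm_on_reg17UnivP τ hτt hτs hτp hL2 (cubeLamBP L a Mc ρ i.k) ops₀ M i m hfin
  have h1 := one_mem_reg17UnivP (d := d) (𝔸 := 𝔸) hL1 m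
  refine regularAtH_of_bondPair_pos τ hfin (hstr.1 1 h1) (hstr.2 1 h1) fun A hA hA0 => ?_
  rw [mem_domSubH_iff] at hA
  exact flat_posDef_herm_cube τ hτt hτs hτp hd2 hL2 ops₀ M i hΩ hΛs hm hA.1 hA.2 hA0

include hτp hτt hτs in
/-- ★★★ **`G_𝔤(U₀)` EXISTS ON THE WHOLE WINDOW-SIZED BALL AROUND THE FLAT BACKGROUND, FROM THE BOUND ON `|G|`**: at a cube member (class `cubeLamBP`, `m ≤ k`,
`2 ≤ d`, `2 ≤ L ≤ ρ`), `0 < δ`, `4δ < (α_Q∕L²)L^{−2m}`: IF at the regular points of the uniform `δ`-ball `‖G_𝔤(U₀)‖_τ ≤ c^{−1∕2}` uniformly (displayed as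
`c·⟨A, A⟩_τ ≤ ⟨□₀Δ_a(U₀)A, □₀Δ_a(U₀)A⟩_τ` — print's (3.115)), THEN `Δ_a(U₀)↾□₀` is invertible on `E_𝔤(□₀)` for EVERY `U₀` of the ball.
[cite: Balaban1985BackgroundPropagators, Thm 3.11 p.416, (3.115) p.418, (3.27) p.395; Balaban1985RegularSpaces, (1.7) p.77, (1.131) p.99] -/
theorem regularAtH_on_ball_of_gbound (hd2 : 2 ≤ d) (hL2 : 2 ≤ L) (ops₀ : ℝ → ZdIdx d L → ℕ → OpsZd d 𝔸) (M : ℝ) (i : ZdIdx d L)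
    {a : Site d} {Mc ρ : ℕ} (hΩ : i.Ω = cubeFam false L a Mc ρ i.k) (hΛs : i.Λs = cubeLamS L a Mc ρ i.k) (hρ : L ≤ ρ) {m : ℕ} (hm : m ≤ i.k)
    {δ : ℝ} (hδ0 : 0 < δ) (hδ : 4 * δ < alphaQ d L / (L : ℝ) ^ 2 * (((L : ℝ) ^ m)⁻¹) ^ 2) {c : ℝ} (hc : 0 < c)
    (hbound : ∀ U₀ ∈ {U : Site d → Fin d → 𝔸ˣ | (∀ x κ, U x κ ∈ unitaryUnits 𝔸) ∧ ∀ x κ, ‖((U x κ : 𝔸ˣ) : 𝔸) - 1‖ < δ},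
      RegularAtH i.η (opsAllZd τ L (cubeLamBP L a Mc ρ i.k) ops₀ M i m) (i.Ω 0) U₀ →
        ∀ A ∈ domSubH (𝔸 := 𝔸) (i.Ω 0), c * bondPair τ A A ≤
          bondPair τ (deltaADom i.η (opsAllZd τ L (cubeLamBP L a Mc ρ i.k) ops₀ M i m) (i.Ω 0) U₀ A)
            (deltaADom i.η (opsAllZd τ L (cubeLamBP L a Mc ρ i.k) ops₀ M i m) (i.Ω 0) U₀ A)) :
    ∀ U₀ ∈ {U : Site d → Fin d → 𝔸ˣ | (∀ x κ, U x κ ∈ unitaryUnits 𝔸) ∧ ∀ x κ, ‖((U x κ : 𝔸ˣ) : 𝔸) - 1‖ < δ},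
      RegularAtH i.η (opsAllZd τ L (cubeLamBP L a Mc ρ i.k) ops₀ M i m) (i.Ω 0) U₀ := by
  haveI : NeZero L := ⟨by omega⟩
  have hL1 : 1 ≤ L := le_trans (by norm_num) hL2
  have hfin := cubeMember_Ω0_finite i hΩ
  have hS𝒰 := ball_subset_reg17UnivP (d := d) (𝔸 := 𝔸) hL1 m hδ
  have hstr := linear_herm_on_reg17UnivP τ hτt hτs hτp hL2 (cubeLamBP L a Mc ρ i.k) ops₀ M i m hfin
  exact regularAtH_on_of_isPreconnected τ hτp hfin (isPreconnected_ball hδ0 (delta_le_two_of_window hL1 hδ))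
    (fun U₀ hU => hstr.1 U₀ (hS𝒰 hU)) (fun U₀ hU => hstr.2 U₀ (hS𝒰 hU))
    (fun U₁ hU₁ => (lettersContinuousWithinAt_opsAllZd_cube_reg17UnivP τ hτp hτt hτs hd2 hL2 (cubeLamBP L a Mc ρ i.k) ops₀ M i hΩ hΛs hρ hm
      (hS𝒰 hU₁)).mono_set hS𝒰) hc hbound (one_mem_ball hδ0) (regularAtH_one_cube τ hτp hτt hτs hd2 hL2 ops₀ M i hΩ hΛs hm)

include hτp hτt hτs in
/-- ★★★ **`G_𝔤(U₀)` ON PRINT'S LOCAL CLASS, EXPLICIT WINDOW, FROM THE BOUND ON `|G|` ON THE BALL**: at a cube member, `0 < δ`, `4δ < (α_Q∕L²)L^{−2m}`, the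
displayed bound at the regular points of the `δ`-ball ⟹ `Δ_a(U₀)↾□₀` is invertible on `E_𝔤(□₀)` for EVERY unitary `U₀` whose plaquettes TOUCHING `□₀` are
`α`-close to `1`, any `α ≥ 0` with `(|□₀|₁ + 1)·α < δ` — layer gauge + cut-off (this seat's `of_touching_plaquettes_unitary_explicit`), (G) box-clause
covariance (`regularAtH_opsAllZd_gaugeAct_iff`), (L) dag-n06-b g20's sides locality. [cite: Balaban1985BackgroundPropagators, Thm 3.11 p.416, (3.115) p.418, (3.27) p.395, (3.34)–(3.36) p.396; Balaban1985RegularSpaces, (1.7) p.77, Lemma 1 p.79, (1.131) p.99] -/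
theorem regularAtH_of_plaqTouches_of_gbound (hd2 : 2 ≤ d) (hL2 : 2 ≤ L) (ops₀ : ℝ → ZdIdx d L → ℕ → OpsZd d 𝔸) (M : ℝ) (i : ZdIdx d L)
    {a : Site d} {Mc ρ : ℕ} (hρ : L ≤ ρ) (hΩ : i.Ω = cubeFam false L a Mc ρ i.k) (hΛs : i.Λs = cubeLamS L a Mc ρ i.k) {m : ℕ} (hm : m ≤ i.k)
    {δ : ℝ} (hδ0 : 0 < δ) (hδ : 4 * δ < alphaQ d L / (L : ℝ) ^ 2 * (((L : ℝ) ^ m)⁻¹) ^ 2) {c : ℝ} (hc : 0 < c)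
    (hbound : ∀ U₀ ∈ {U : Site d → Fin d → 𝔸ˣ | (∀ x κ, U x κ ∈ unitaryUnits 𝔸) ∧ ∀ x κ, ‖((U x κ : 𝔸ˣ) : 𝔸) - 1‖ < δ},
      RegularAtH i.η (opsAllZd τ L (cubeLamBP L a Mc ρ i.k) ops₀ M i m) (i.Ω 0) U₀ →
        ∀ A ∈ domSubH (𝔸 := 𝔸) (i.Ω 0), c * bondPair τ A A ≤
          bondPair τ (deltaADom i.η (opsAllZd τ L (cubeLamBP L a Mc ρ i.k) ops₀ M i m) (i.Ω 0) U₀ A)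
            (deltaADom i.η (opsAllZd τ L (cubeLamBP L a Mc ρ i.k) ops₀ M i m) (i.Ω 0) U₀ A))
    {α : ℝ} (hα : 0 ≤ α) (hαδ : ((B7Prop1Explicit.l1 (sqHi L a Mc ρ i.k 0 - sqLo L a ρ i.k 0) : ℝ) + 1) * α < δ)
    {U₀ : Site d → Fin d → 𝔸ˣ} (hU₀ : ∀ x κ, U₀ x κ ∈ unitaryUnits 𝔸)
    (hsmall : ∀ (z : Site d) (κ μ : Fin d), κ ≠ μ → PlaqTouches (i.Ω 0) z κ μ → ‖plaqF U₀ κ μ z - 1‖ ≤ α) :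
    RegularAtH i.η (opsAllZd τ L (cubeLamBP L a Mc ρ i.k) ops₀ M i m) (i.Ω 0) U₀ := by
  haveI : NeZero L := ⟨by omega⟩
  have hL1 : 1 ≤ L := le_trans (by norm_num) hL2
  have hfin : (i.Ω 0).Finite := cubeMember_Ω0_finite i hΩ
  have hset : {y : Site d | InBox (sqLo L a ρ i.k 0) (sqHi L a Mc ρ i.k 0) y} = i.Ω 0 := by
    rw [hΩ, cubeFam_false_zero]; ext y; exact (mem_cube_zero_iff L a Mc ρ i.k y).symm
  have hbox := hbox0_cubeLamBP_of_eq hL1 i a Mc hρ hΩ hm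
  refine of_touching_plaquettes_unitary_explicit (𝔸 := 𝔸) (sqLo_le_sqHi_zero L a Mc (le_trans hL1 hρ) i.k)
    (P := fun V => RegularAtH i.η (opsAllZd τ L (cubeLamBP L a Mc ρ i.k) ops₀ M i m) (i.Ω 0) V)
    (fun V hV hVδ => ?_) (fun u V hu hV hPV => ?_) (fun U U' hU hU' hag hPU => ?_) hα hαδ hU₀
    (fun z κ μ hκμ hpt => hsmall z κ μ hκμ (by rw [hset] at hpt; exact hpt))
  · exact regularAtH_on_ball_of_gbound τ hτp hτt hτs hd2 hL2 ops₀ M i hΩ hΛs hρ hm hδ0 hδ hc hbound V ⟨hV, hVδ⟩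
  · exact (B9Eq334GaugeCovarianceZdHerm.regularAtH_opsAllZd_gaugeAct_iff τ L (cubeLamBP L a Mc ρ i.k) ops₀ M i m hL2 hbox hτt hτs hτp hV hu hfin).mpr hPV
  · rw [hset] at hag
    exact (regular_opsAllZd_congr_cube_sides τ hd2 hL2 ops₀ M i hρ hΩ hΛs hfin hm hag).1.mp hPU

include hτp hτt hτs in
/-- ★★★ **THE JUNCTION'S (3.27) BINDER `InvAtHI` FROM THE BOUND ON `|G|`, EXPLICIT THRESHOLD**: every `aI ≥ 0` with `(|□₀|₁ + 1)·aI < δ` works (dag-n06-b g20's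
`InvAtHI L (withGopZdH (opsAllZd …)) aI M i m`). [cite: Balaban1985BackgroundPropagators, (3.27) p.395, Thm 3.11 p.416, (3.115) p.418; Balaban1985RegularSpaces, (1.58) p.86, (1.7) p.77] -/
theorem invAtHI_withGopZdH_of_gbound (hd2 : 2 ≤ d) (hL2 : 2 ≤ L) (ops₀ : ℝ → ZdIdx d L → ℕ → OpsZd d 𝔸) (M : ℝ) (i : ZdIdx d L)
    {a : Site d} {Mc ρ : ℕ} (hρ : L ≤ ρ) (hΩ : i.Ω = cubeFam false L a Mc ρ i.k) (hΛs : i.Λs = cubeLamS L a Mc ρ i.k) {m : ℕ} (hm : m ≤ i.k)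
    {δ : ℝ} (hδ0 : 0 < δ) (hδ : 4 * δ < alphaQ d L / (L : ℝ) ^ 2 * (((L : ℝ) ^ m)⁻¹) ^ 2) {c : ℝ} (hc : 0 < c)
    (hbound : ∀ U₀ ∈ {U : Site d → Fin d → 𝔸ˣ | (∀ x κ, U x κ ∈ unitaryUnits 𝔸) ∧ ∀ x κ, ‖((U x κ : 𝔸ˣ) : 𝔸) - 1‖ < δ},
      RegularAtH i.η (opsAllZd τ L (cubeLamBP L a Mc ρ i.k) ops₀ M i m) (i.Ω 0) U₀ →
        ∀ A ∈ domSubH (𝔸 := 𝔸) (i.Ω 0), c * bondPair τ A A ≤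
          bondPair τ (deltaADom i.η (opsAllZd τ L (cubeLamBP L a Mc ρ i.k) ops₀ M i m) (i.Ω 0) U₀ A)
            (deltaADom i.η (opsAllZd τ L (cubeLamBP L a Mc ρ i.k) ops₀ M i m) (i.Ω 0) U₀ A))
    {aI : ℝ} (haI : 0 ≤ aI) (haIδ : ((B7Prop1Explicit.l1 (sqHi L a Mc ρ i.k 0 - sqLo L a ρ i.k 0) : ℝ) + 1) * aI < δ) :
    InvAtHI L (withGopZdH (opsAllZd τ L (cubeLamBP L a Mc ρ i.k) ops₀)) aI M i m := by
  refine invAtHI_of_forall L fun α₀ hα₀ U₀ hU₀ hIn A hA J hJ => ?_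
  have hN : (0 : ℝ) < (B7Prop1Explicit.l1 (sqHi L a Mc ρ i.k 0 - sqLo L a ρ i.k 0) : ℝ) + 1 := by positivity
  have hreg := regularAtH_of_plaqTouches_of_gbound τ hτp hτt hτs hd2 hL2 ops₀ M i hρ hΩ hΛs hm hδ0 hδ hc hbound (le_max_right α₀ 0)
    (lt_of_le_of_lt (mul_le_mul_of_nonneg_left (max_le hα₀ haI) hN.le) haIδ) hU₀
    (fun z κ μ hκμ hpt => (plaq_le_of_inAk hIn z κ μ hκμ hpt).trans (le_max_left _ _))
  rw [withGopZdH_Gop]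
  exact gopZdH_apply_eq_of_regularAtH i.η _ (i.Ω 0) U₀ hreg hA fun y μ hb => by rw [hJ y μ hb, deltaAOf_withGopZdH]

end Cube

end Literature.MathematicalPhysics.QuantumFieldTheory.Balaban1983to89.B9Thm311ContinuityMethodRegularZd

end
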